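import Summits.RiemannHypothesis.RiemannHypothesis.Theorems.WeilGroundStateGroundStatesConvergeToXiStubPrimeTermTruncation
import Summits.RiemannHypothesis.RiemannHypothesis.Theorems.WeilGroundStateGroundStatesConvergeToXiUniformBound
import Literature.NumberTheory.LFunctions.WeilExplicit
import Literature.NumberTheory.LFunctions.WeilExplicitProofs
import Mathlib.Analysis.Normed.Group.Tannery
import HarnessLib

/-!
# `WeilGroundState.GroundStatesConvergeToXi` — the Weil functional under dominated pointwise convergence
(crux item stmt-RiemannHypothesis-1527, route route-RiemannHypothesis-WeilGroundState; line `Sketch`,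
stub `stub_weilFunctional_dominated` (H2); `--supports`)

The EXPONENTIAL WEIL CLASS: smooth `F : ℝ → ℂ` with `‖F‖, ‖F'‖, ‖F''‖ ≤ C e^{-b₀|t|}`, `b₀ > 1/2`.
For a sequence `F_k` in the class with a COMMON envelope (same `C`, `b₀`) converging pointwise to a
continuous `G`:

* the prime sides converge, `weilPrimeTerm F_k → weilPrimeTerm G`
  (`weilPrimeTerm F = Σ_n Λ(n) n^{-1/2} (F(log n) + F(-log n))`): Tannery's theorem
  (`tendsto_tsum_of_dominated_convergence`) with the summable majorant
  `2C Λ(n) n^{-1/2} e^{-b₀ log n} = 2C Λ(n) n^{-(1/2 + b₀)}` (`uniformBound_summable_vonMangoldt`,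
  `1/2 + b₀ > 1`); termwise convergence is the pointwise hypothesis at `± log n`;
* granted the convergence of the polar and archimedean sides (stub H1, taken as a hypothesis),
  the whole Weil functional `W = weilPolarTerm - weilPrimeTerm + weilArchTerm` converges,
  `W(F_k) → W(G)`.

Only the envelope of `F_k` itself is used on the prime side (no smoothness, no derivative bounds).
No new definitions; no named fact is used.
-/

noncomputable section

set_option linter.dupNamespace false

open scoped Topology Real ComplexConjugate ArithmeticFunction.vonMangoldt
open Filter Set MeasureTheory Complex

namespace Summit.RiemannHypothesis.RiemannHypothesis.Theorems.GroundStatesConvergeToXi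

open Literature.NumberTheory.LFunctions

/-- **Termwise domination of the prime side by the envelope.** If `‖F(x)‖ ≤ C e^{-b|x|}` then for
every `n`, `‖Λ(n)/√n · (F(log n) + F(-log n))‖ ≤ 2C · (Λ(n)/√n · e^{-b log n})`. [folklore] -/
theorem wfDom_norm_primeTerm_summand_le {F : ℝ → ℂ} {C b : ℝ}
    (hF : ∀ x, ‖F x‖ ≤ C * Real.exp (-(b * |x|))) (n : ℕ) :
    ‖((Λ n : ℝ) : ℂ) / (Real.sqrt n : ℂ) * (F (Real.log n) + F (-Real.log n))‖ ≤
      2 * C * ((Λ n : ℝ) / Real.sqrt n * Real.exp (-(b * Real.log n))) := by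
  have hlog : 0 ≤ Real.log (n : ℝ) := Real.log_natCast_nonneg n
  have h1 : ‖F (Real.log n)‖ ≤ C * Real.exp (-(b * Real.log n)) := by
    simpa [abs_of_nonneg hlog] using hF (Real.log n)
  have h2 : ‖F (-Real.log n)‖ ≤ C * Real.exp (-(b * Real.log n)) := by
    simpa [abs_neg, abs_of_nonneg hlog] using hF (-Real.log n)
  rw [norm_mul, norm_div, Complex.norm_real, Complex.norm_real,
    Real.norm_of_nonneg ArithmeticFunction.vonMangoldt_nonneg,
    Real.norm_of_nonneg (Real.sqrt_nonneg _)]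
  calc (Λ n : ℝ) / Real.sqrt n * ‖F (Real.log n) + F (-Real.log n)‖
      ≤ (Λ n : ℝ) / Real.sqrt n *
          (C * Real.exp (-(b * Real.log n)) + C * Real.exp (-(b * Real.log n))) :=
        mul_le_mul_of_nonneg_left (norm_add_le_of_le h1 h2)
          (div_nonneg ArithmeticFunction.vonMangoldt_nonneg (Real.sqrt_nonneg _))
    _ = 2 * C * ((Λ n : ℝ) / Real.sqrt n * Real.exp (-(b * Real.log n))) := by ring

/-- **The prime side under dominated pointwise convergence.** If `‖F_k(x)‖ ≤ C e^{-b₀|x|}` for all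
`k, x` with `b₀ > 1/2` and `F_k → G` pointwise, then `weilPrimeTerm F_k → weilPrimeTerm G`
(Tannery's theorem with the majorant `2C Λ(n) n^{-1/2} e^{-b₀ log n}`, summable by
`uniformBound_summable_vonMangoldt`). [folklore] -/
theorem wfDom_tendsto_weilPrimeTerm {F : ℕ → ℝ → ℂ} {G : ℝ → ℂ} {C b₀ : ℝ} (hb : 1 / 2 < b₀)
    (h0 : ∀ k t, ‖F k t‖ ≤ C * Real.exp (-(b₀ * |t|)))
    (hpt : ∀ t, Tendsto (fun k => F k t) atTop (𝓝 (G t))) :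
    Tendsto (fun k => weilPrimeTerm (F k)) atTop (𝓝 (weilPrimeTerm G)) := by
  unfold weilPrimeTerm
  exact tendsto_tsum_of_dominated_convergence
    ((uniformBound_summable_vonMangoldt hb).mul_left (2 * C))
    (fun n => tendsto_const_nhds.mul ((hpt _).add (hpt _)))
    (Eventually.of_forall fun k n => wfDom_norm_primeTerm_summand_le (h0 k) n)

/-- **Stub H2 — `weilFunctional_dominated` (RH-free; takes H1 as hypothesis).**  Under the
hypotheses of H1 (smooth `F_k` with a common envelope `‖F_k‖, ‖F_k'‖, ‖F_k''‖ ≤ C e^{-b₀|t|}`,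
`b₀ > 1/2`, `F_k → G` pointwise, `G` continuous) the prime sides converge (Tannery, majorant
`2C Λ(n) n^{-1/2-b₀}`, `uniformBound_summable_vonMangoldt`) and hence, with the polar and
archimedean limits supplied by H1, the whole Weil functional: `W(F_k) → W(G)`. [folklore] -/
theorem stub_weilFunctional_dominated :
    (∀ (F : ℕ → ℝ → ℂ) (G : ℝ → ℂ) (C b₀ : ℝ), 1 / 2 < b₀ →
      (∀ k, ContDiff ℝ (⊤ : ℕ∞) (F k)) → Continuous G →
      (∀ k t, ‖F k t‖ ≤ C * Real.exp (-(b₀ * |t|))) →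
      (∀ k t, ‖deriv (F k) t‖ ≤ C * Real.exp (-(b₀ * |t|))) →
      (∀ k t, ‖deriv (deriv (F k)) t‖ ≤ C * Real.exp (-(b₀ * |t|))) →
      (∀ t, Tendsto (fun k => F k t) atTop (𝓝 (G t))) →
      (∀ s : ℂ, 0 ≤ s.re → s.re ≤ 1 →
        Tendsto (fun k => weilMellin (F k) s) atTop (𝓝 (weilMellin G s))) ∧
      Tendsto (fun k => weilPolarTerm (F k)) atTop (𝓝 (weilPolarTerm G)) ∧
      Tendsto (fun k => weilArchTerm (F k)) atTop (𝓝 (weilArchTerm G))) →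
    ∀ (F : ℕ → ℝ → ℂ) (G : ℝ → ℂ) (C b₀ : ℝ), 1 / 2 < b₀ →
      (∀ k, ContDiff ℝ (⊤ : ℕ∞) (F k)) → Continuous G →
      (∀ k t, ‖F k t‖ ≤ C * Real.exp (-(b₀ * |t|))) →
      (∀ k t, ‖deriv (F k) t‖ ≤ C * Real.exp (-(b₀ * |t|))) →
      (∀ k t, ‖deriv (deriv (F k)) t‖ ≤ C * Real.exp (-(b₀ * |t|))) →
      (∀ t, Tendsto (fun k => F k t) atTop (𝓝 (G t))) →
      Tendsto (fun k => weilPrimeTerm (F k)) atTop (𝓝 (weilPrimeTerm G)) ∧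
      Tendsto (fun k => weilFunctional (F k)) atTop (𝓝 (weilFunctional G)) := by
  intro H1 F G C b₀ hb hF hG h0 h1 h2 hpt
  have hprime : Tendsto (fun k => weilPrimeTerm (F k)) atTop (𝓝 (weilPrimeTerm G)) :=
    wfDom_tendsto_weilPrimeTerm hb h0 hpt
  obtain ⟨-, hpolar, harch⟩ := H1 F G C b₀ hb hF hG h0 h1 h2 hpt
  refine ⟨hprime, ?_⟩
  unfold weilFunctional
  exact (hpolar.sub hprime).add harch

end Summit.RiemannHypothesis.RiemannHypothesis.Theorems.GroundStatesConvergeToXi
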